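import Literature.NumberTheory.DiophantineGeometry.AbcShapeExponents
import Literature.NumberTheory.DiophantineGeometry.AbcShapeSubBox

/-!
# drefute (refuter-drefute-stmt-ABC-2757-g2-0): the ROOT TOOL missing from the kit of line
`fibre-toolkit-lp-wall-map` — typed target signatures for the lead (statements only; the proofs are
elementary: fibre, then `z^{i+1}` is fixed modulo the host cofactor up to `(2(i+1))^{ω}` roots of unity,
each root class meets `[Zᵢ, 2Zᵢ)` in `≤ Zᵢ/F₀ + 1` points, and the host's linear variable is determined).

Exponent form: `D ≤ max(L − W_host, L − m_{host,1} − m_{other,i+1}) + O((i+2) log_Λ Dτ + log_Λ 2)`,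
`W_host = log_Λ(c_host · shapeVal X_host)`. It certifies every ASYMMETRIC wall box (the kit-worst boxes on
`[12/7, 2)`) at the law `s − 1`; see DrefuteFibreToolkitLpWallMap.md / stubs/stub_wallResidual.md §3.
-/

noncomputable section

open Finset
open Literature.NumberTheory.DiophantineGeometry
open Literature.NumberTheory.DiophantineGeometry.AbcShapes

namespace Summit.ABC.ABC.Cruxes.MazurKaneLaw.Drefute

/-- ROOT TOOL, host = the `x`-term (its linear coordinate `i₀` free), power coordinate `i ≥ 1` of the
`z`-term: `B_d ≤ #subBox_{i₀} X · #box Y · #subBox_{i} Z · Dτ^{i+2} · (Zᵢ/F₀ + 1)`,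
`F₀ = c₁ · offVal_{i₀}(X)` (lower corner of the host cofactor). -/
def RootToolXZ : Prop :=
  ∀ {d : ℕ} {c₁ c₂ c₃ : ℕ}, 0 < c₁ → 0 < c₂ → 0 < c₃ →
    ∀ (X Y Z : Fin d → ℕ), (∀ j, 0 < X j) → (∀ j, 0 < Y j) → (∀ j, 0 < Z j) →
    ∀ {T Dτ : ℕ}, c₁ * shapeVal (fun j => 2 * X j) ≤ T → c₂ * shapeVal (fun j => 2 * Y j) ≤ T →
      c₃ * shapeVal (fun j => 2 * Z j) ≤ T → (∀ m : ℕ, m ≠ 0 → m ≤ T → m.divisors.card ≤ Dτ) →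
    ∀ i₀ i : Fin d, (i₀ : ℕ) = 0 → 1 ≤ (i : ℕ) →
      (shapeCount c₁ c₂ c₃ X Y Z : ℝ) ≤
        ((subBox ({i₀} : Finset (Fin d)) X).card * (dyadicBox Y).card *
            (subBox ({i} : Finset (Fin d)) Z).card : ℕ) *
          (Dτ : ℝ) ^ ((i : ℕ) + 2) *
            ((Z i : ℝ) / ((c₁ * offVal ({i₀} : Finset (Fin d)) X : ℕ) : ℝ) + 1)

/-- ROOT TOOL, host = the `z`-term, power coordinate `i ≥ 1` of the `x`-term. -/
def RootToolZX : Prop :=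
  ∀ {d : ℕ} {c₁ c₂ c₃ : ℕ}, 0 < c₁ → 0 < c₂ → 0 < c₃ →
    ∀ (X Y Z : Fin d → ℕ), (∀ j, 0 < X j) → (∀ j, 0 < Y j) → (∀ j, 0 < Z j) →
    ∀ {T Dτ : ℕ}, c₁ * shapeVal (fun j => 2 * X j) ≤ T → c₂ * shapeVal (fun j => 2 * Y j) ≤ T →
      c₃ * shapeVal (fun j => 2 * Z j) ≤ T → (∀ m : ℕ, m ≠ 0 → m ≤ T → m.divisors.card ≤ Dτ) →
    ∀ i₀ i : Fin d, (i₀ : ℕ) = 0 → 1 ≤ (i : ℕ) →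
      (shapeCount c₁ c₂ c₃ X Y Z : ℝ) ≤
        ((subBox ({i} : Finset (Fin d)) X).card * (dyadicBox Y).card *
            (subBox ({i₀} : Finset (Fin d)) Z).card : ℕ) *
          (Dτ : ℝ) ^ ((i : ℕ) + 2) *
            ((X i : ℝ) / ((c₃ * offVal ({i₀} : Finset (Fin d)) Z : ℕ) : ℝ) + 1)

/-- ROOT TOOL, host = the `x`-term, power coordinate `i ≥ 1` of the `y`-term (the `y`-host cases follow by
the symmetry `shapeCount c₁ c₂ c₃ X Y Z = shapeCount c₂ c₁ c₃ Y X Z`). -/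
def RootToolXY : Prop :=
  ∀ {d : ℕ} {c₁ c₂ c₃ : ℕ}, 0 < c₁ → 0 < c₂ → 0 < c₃ →
    ∀ (X Y Z : Fin d → ℕ), (∀ j, 0 < X j) → (∀ j, 0 < Y j) → (∀ j, 0 < Z j) →
    ∀ {T Dτ : ℕ}, c₁ * shapeVal (fun j => 2 * X j) ≤ T → c₂ * shapeVal (fun j => 2 * Y j) ≤ T →
      c₃ * shapeVal (fun j => 2 * Z j) ≤ T → (∀ m : ℕ, m ≠ 0 → m ≤ T → m.divisors.card ≤ Dτ) →
    ∀ i₀ i : Fin d, (i₀ : ℕ) = 0 → 1 ≤ (i : ℕ) →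
      (shapeCount c₁ c₂ c₃ X Y Z : ℝ) ≤
        ((subBox ({i₀} : Finset (Fin d)) X).card * (subBox ({i} : Finset (Fin d)) Y).card *
            (dyadicBox Z).card : ℕ) *
          (Dτ : ℝ) ^ ((i : ℕ) + 2) *
            ((Y i : ℝ) / ((c₁ * offVal ({i₀} : Finset (Fin d)) X : ℕ) : ℝ) + 1)

/-- The radical exponent of a box (as in the skeleton). -/
def radExp' {M : ℕ} (Λ : ℝ) (X Y Z : Fin M → ℕ) : ℝ :=
  ∑ i, (expo Λ X i + expo Λ Y i + expo Λ Z i)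

/-- ROOT CERTIFICATE (exponent form of the six host/power choices): some host term `t` with linear
coordinate `i₀` and some power coordinate `i ≥ 1` of another term with
`L − log_Λ(c_t · shapeVal X_t) ≤ θ ∧ L − m_{t,1} − m_{other,i+1} ≤ θ`. Proposed 5th disjunct of `Tame`. -/
def RootCertifies {M : ℕ} (Λ θ : ℝ) (c₁ c₂ c₃ : ℕ) (X Y Z : Fin M → ℕ) : Prop :=
  ∃ i₀ i : Fin M, (i₀ : ℕ) = 0 ∧ 1 ≤ (i : ℕ) ∧
    ((radExp' Λ X Y Z - Real.logb Λ ((c₁ * shapeVal X : ℕ) : ℝ) ≤ θ ∧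
        (radExp' Λ X Y Z - expo Λ X i₀ - expo Λ Z i ≤ θ ∨ radExp' Λ X Y Z - expo Λ X i₀ - expo Λ Y i ≤ θ)) ∨
     (radExp' Λ X Y Z - Real.logb Λ ((c₂ * shapeVal Y : ℕ) : ℝ) ≤ θ ∧
        (radExp' Λ X Y Z - expo Λ Y i₀ - expo Λ Z i ≤ θ ∨ radExp' Λ X Y Z - expo Λ Y i₀ - expo Λ X i ≤ θ)) ∨
     (radExp' Λ X Y Z - Real.logb Λ ((c₃ * shapeVal Z : ℕ) : ℝ) ≤ θ ∧
        (radExp' Λ X Y Z - expo Λ Z i₀ - expo Λ X i ≤ θ ∨ radExp' Λ X Y Z - expo Λ Z i₀ - expo Λ Y i ≤ θ)))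

end Summit.ABC.ABC.Cruxes.MazurKaneLaw.Drefute

end
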